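import Literature.Analysis.FluidPDE.TaoMultiplierToolkit
import HarnessLib

/-!
# Barrier: the «sup over all derivative orders» class IS the band-limited class, and the quadratic
# term does not preserve it — no time-uniform scheme in the `H^∞` max-norm survives `(u·∇)u`

Barrier catalogue entry for `NavierStokesRegularity` (D-0021), METHOD LEVEL, everything PROVED
(measure theory on the Fourier side, in the tree's `L²(ℝ³; ℂ³)` vocabulary
`Literature.Analysis.FluidPDE.Tao2016.{L2C, fourierFn, IsBandLimited}`; physical-side companion
`Literature.Barriers.NavierStokesRegularity.BandLimited.not_bddAbove_dirDeriv_convect_velocity`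
in `BandLimitedFrequencyDoubling.lean`).

A recurring scheme (cell `ns-claims`, row C26: Han, arXiv:1307.1012v1 — withdrawn in v2 by the
author, «crucial error in Section 2») equips `∩_m H^m(ℝ³)` with the **max-norm**
`‖u‖_{H^∞} := max_{m ≥ 0} Σ_{j=1}^{3} ‖∂_j^m u‖_{L²}` — ALL pure derivatives UNIFORMLY bounded in
`L²` — proves LINEAR (forced Stokes) estimates in it for `u` and for the convective quantity
`(u·∇)u`, «sums over `j`, takes the maximum over `m ≥ 0`, then uses the Gronwall inequality», and
transfers the bound to Navier–Stokes by a fixed point plus a second Gronwall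
[cite: Han2013, Lemma 2.1 (EnEs-LNS1)–(EnEs-LNS4) l.435–470 with the sentence after (2.21), l.575–578; Lemma 4.1 l.831–845].
By Plancherel, `‖∂_j^m u‖²_{L²} = ∫ (2π|ξ_j|)^{2m} |û(ξ)|² dξ`, so the scheme's standing hypothesis is
a UNIFORM bound on all these moments. This file proves, at that (Fourier-side) grain:

* `ae_eq_zero_of_uniform_moments` (abstract Paley–Wiener half): on any measure space, if
  `∫ w^m · G ≤ K < ∞` for every `m ∈ ℕ` then `G = 0` a.e. on `{w > 1}`; with the Bernstein half
  `lintegral_pow_mul_le_of_ae_zero` (`G = 0` a.e. on `{w > 1}` ⇒ `∫ w^m G ≤ ∫ G` for all `m`).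
* `isBandLimited_slab_of_uniform_moments` / `uniform_moments_of_isBandLimited_slab`: for
  `f ∈ L²(ℝ³; ℂ³)`, ALL the moments `∫ (2π|ξ_j|)^{2m} |f̂|²` are bounded by one `K < ∞` **iff**
  `f̂ = 0` a.e. off the slab `{|ξ_j| ≤ 1/(2π)}` — i.e. the max-norm class in direction `j` is
  EXACTLY the class of fields band-limited to that slab (all three directions: the cube). In
  particular the class is a CLOSED LINEAR subspace defined by a Fourier SUPPORT condition, and a
  quadratic expression in `u` lies in it only if its Fourier transform — a convolution
  `û * (ξû)`, supported up to the DOUBLED cube — happens to vanish on the outer shell.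
* The physical-side companion file exhibits the doubling on the tree's Taylor–Green datum
  [cite: TaylorGreen1937, eqs. (12)–(15)]: `|∂_j^m u_i| ≤ 1` for all `m` while
  `sup_{m,x} |∂_1^m ((u·∇)u)_1| = ∞` (`BandLimited.abs_dirDeriv_velocity_le_one`,
  `BandLimited.not_bddAbove_dirDeriv_convect_velocity`), and the tree's
  `TaylorGreenVortex.convect_add_gradient_pressure` / `initialAcceleration_eq` put the
  divergence-free part of the nonlinearity, hence `∂ₜu(0)` itself, on the doubled modes.

Consequence for the scheme: `X(t) := ‖(u·∇)u(t)‖²_{H^∞}` is `+∞` as soon as the band is exceeded,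
and «Gronwall in `[0,∞]`» is false (kernel: `Summit.NavierStokesRegularity.NavierStokesRegularity.
Theorems.Han2013.not_Step_L21G`, p478733, witness `X(0) = 0`, `X(t) = ⊤` for `t > 0`); the class is
not invariant under `u ↦ (u·∇)u`, nor under the forced Stokes flow with band-edge forcing, nor
(generically) under Navier–Stokes for positive times. The honest propagated quantity is a
time-DEPENDENT analyticity/Gevrey radius [cite: FoiasTemam1989, Thm. p. 360 (Gevrey class regularity, radius growing like `t` for small `t`)].

## References

* Y. Han, arXiv:1307.1012v1 [math.AP] (2013), withdrawn v2; Lemma 2.1, Lemma 4.1. [`Han2013`]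
* C. Foias, R. Temam, *Gevrey class regularity for the solutions of the Navier–Stokes equations*,
  J. Funct. Anal. 87 (1989) 359–369. [`FoiasTemam1989`]
* H. Bahouri, J.-Y. Chemin, R. Danchin, *Fourier Analysis and Nonlinear PDEs*, Grundlehren 343
  (2011), Lemma 2.1 p. 52 (Bernstein inequalities for band-limited functions). [`BahouriCheminDanchinGL343`]
* L. Grafakos, *Classical Fourier Analysis*, 3rd ed. (2014), §2.2–2.3 (Plancherel, `∂_j ↔ 2πiξ_j`). [`Grafakos2014`]
* G. I. Taylor, A. E. Green, Proc. R. Soc. A 158 (1937) 499–521. [`TaylorGreen1937`]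

WHAT THIS IS NOT: not a claim about NS regularity or blow-up; not a claim about any author beyond
the typed locator.
-/

noncomputable section

open MeasureTheory Set Filter Topology
open scoped ENNReal NNReal

namespace Literature.Barriers.NavierStokesRegularity

namespace BandLimited

/-! ## The abstract dichotomy: uniform moments of all orders ⇔ support in `{w ≤ 1}` -/

section Abstract

variable {X : Type*} [MeasurableSpace X] {μ : Measure X} {w G : X → ℝ≥0∞}

/-- **Paley–Wiener half (abstract): uniformly bounded moments of ALL orders force vanishing off
the unit band.** If `w` is measurable, `G` a.e.-measurable and `∫ w^m G dμ ≤ K < ∞` for every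
`m ∈ ℕ`, then `G = 0` a.e. on `{w > 1}`. (On `{w ≥ 1 + ε}` the `m`-th moment dominates
`(1+ε)^m ∫_{w ≥ 1+ε} G`, unbounded in `m` unless the set integral vanishes; then exhaust `{w > 1}`
by `ε = 1/(n+1)`.) [cite: BahouriCheminDanchinGL343, Lemma 2.1 (Bernstein inequalities), book p. 52 — `L²` case with its converse] -/
theorem ae_eq_zero_of_uniform_moments (hw : Measurable w) (hG : AEMeasurable G μ) {K : ℝ≥0∞}
    (hK : K ≠ ∞) (h : ∀ m : ℕ, ∫⁻ x, w x ^ m * G x ∂μ ≤ K) :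
    ∀ᵐ x ∂μ, 1 < w x → G x = 0 := by
  -- the shells `S n = {1 + 1/(n+1) ≤ w}`
  have hS : ∀ n : ℕ, MeasurableSet {x | 1 + ((n : ℝ≥0∞) + 1)⁻¹ ≤ w x} := fun n =>
    measurableSet_le measurable_const hw
  -- Step 1: the set integral of `G` over each shell vanishes
  have hzero : ∀ n : ℕ, ∫⁻ x in {x | 1 + ((n : ℝ≥0∞) + 1)⁻¹ ≤ w x}, G x ∂μ = 0 := by
    intro n
    set ε : ℝ≥0∞ := ((n : ℝ≥0∞) + 1)⁻¹ with hε
    have hεtop : ε ≠ ⊤ := by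
      rw [hε]; exact ENNReal.inv_ne_top.2 (by positivity)
    set c : ℝ≥0∞ := ∫⁻ x in {x | 1 + ε ≤ w x}, G x ∂μ with hc
    have hbound : ∀ m : ℕ, (1 + ε) ^ m * c ≤ K := by
      intro m
      calc (1 + ε) ^ m * c = ∫⁻ x in {x | 1 + ε ≤ w x}, (1 + ε) ^ m * G x ∂μ := by
            rw [lintegral_const_mul'' _ hG.restrict]
        _ ≤ ∫⁻ x in {x | 1 + ε ≤ w x}, w x ^ m * G x ∂μ := by
            refine setLIntegral_mono' (hS n) fun x hx => ?_
            exact mul_le_mul' (pow_le_pow_left₀ zero_le hx m) le_rfl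
        _ ≤ ∫⁻ x, w x ^ m * G x ∂μ := setLIntegral_le_lintegral _ _
        _ ≤ K := h m
    have hcK : c ≤ K := by simpa using hbound 0
    have hc_top : c ≠ ⊤ := ne_top_of_le_ne_top hK hcK
    by_contra hne
    have hc_pos : 0 < c.toReal := ENNReal.toReal_pos hne hc_top
    have h1ε : 1 < (1 + ε).toReal := by
      rw [ENNReal.toReal_add ENNReal.one_ne_top hεtop, ENNReal.toReal_one]
      have : 0 < ε.toReal := ENNReal.toReal_pos (by rw [hε]; simp) hεtop
      linarith
    obtain ⟨m, hm⟩ := pow_unbounded_of_one_lt (K.toReal / c.toReal) h1ε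
    have hfin : (1 + ε) ^ m * c ≠ ⊤ := ne_top_of_le_ne_top hK (hbound m)
    have hle : ((1 + ε) ^ m * c).toReal ≤ K.toReal := (ENNReal.toReal_le_toReal hfin hK).2 (hbound m)
    rw [ENNReal.toReal_mul, ENNReal.toReal_pow] at hle
    rw [div_lt_iff₀ hc_pos] at hm
    linarith
  -- Step 2: a.e. on each shell, `G = 0`
  have hae : ∀ n : ℕ, ∀ᵐ x ∂μ, x ∈ {x | 1 + ((n : ℝ≥0∞) + 1)⁻¹ ≤ w x} → G x = 0 := by
    intro n
    have h0 : G =ᵐ[μ.restrict {x | 1 + ((n : ℝ≥0∞) + 1)⁻¹ ≤ w x}] 0 :=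
      (lintegral_eq_zero_iff' hG.restrict).1 (hzero n)
    exact (ae_restrict_iff' (hS n)).1 h0
  -- Step 3: exhaust `{w > 1}` by the shells
  rw [← ae_all_iff] at hae
  filter_upwards [hae] with x hx hwx
  obtain ⟨r, hr0, hr⟩ := ENNReal.lt_iff_exists_add_pos_lt.1 hwx
  have hr0' : (r : ℝ≥0∞) ≠ 0 := by exact_mod_cast hr0.ne'
  obtain ⟨n, hn⟩ := ENNReal.exists_inv_nat_lt hr0'
  refine hx n ?_
  show 1 + ((n : ℝ≥0∞) + 1)⁻¹ ≤ w x
  have hmono : ((n : ℝ≥0∞) + 1)⁻¹ ≤ (n : ℝ≥0∞)⁻¹ := ENNReal.inv_le_inv.2 le_self_add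
  calc 1 + ((n : ℝ≥0∞) + 1)⁻¹ ≤ 1 + (r : ℝ≥0∞) := by gcongr; exact hmono.trans hn.le
    _ ≤ w x := hr.le

/-- **Bernstein half (abstract): support in the unit band makes every moment harmless.** If
`G = 0` a.e. on `{w > 1}` then `∫ w^m G ≤ ∫ G` for every `m`. [cite: BahouriCheminDanchinGL343, Lemma 2.1 (Bernstein inequalities), book p. 52 — `L²` case with its converse] -/
theorem lintegral_pow_mul_le_of_ae_zero (h : ∀ᵐ x ∂μ, 1 < w x → G x = 0) (m : ℕ) :
    ∫⁻ x, w x ^ m * G x ∂μ ≤ ∫⁻ x, G x ∂μ := by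
  refine lintegral_mono_ae ?_
  filter_upwards [h] with x hx
  by_cases hwx : 1 < w x
  · rw [hx hwx, mul_zero]
  · push Not at hwx
    calc w x ^ m * G x ≤ 1 ^ m * G x := mul_le_mul' (pow_le_pow_left₀ zero_le hwx m) le_rfl
      _ = G x := by rw [one_pow, one_mul]

end Abstract

/-! ## The `L²(ℝ³)` dictionary: uniform bounds on all `‖∂_j^m f‖_{L²}` ⇔ band-limited to the slab -/

section Slab

open Literature.Analysis.FluidPDE Literature.Analysis.FluidPDE.Tao2016

/-- The squared symbol weight `(2π|ξ_j|)²` of `−∂_j²` is measurable (it is continuous). [folklore] -/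
private theorem measurable_symbolWeight (j : Fin 3) :
    Measurable fun ξ : EuclideanSpace ℝ (Fin 3) => ENNReal.ofReal ((2 * Real.pi * |ξ j|) ^ 2) := by
  have hc : Continuous fun ξ : EuclideanSpace ℝ (Fin 3) => (2 * Real.pi * |ξ j|) ^ 2 :=
    ((continuous_const.mul ((EuclideanSpace.proj j : EuclideanSpace ℝ (Fin 3) →L[ℝ] ℝ).continuous.abs)).pow 2)
  exact ENNReal.measurable_ofReal.comp hc.measurable

/-- Off the slab `{|ξ_j| ≤ 1/(2π)}` the weight exceeds one: `|ξ_j| > 1/(2π) ⇒ (2π|ξ_j|)² > 1`. [folklore] -/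
private theorem one_lt_symbolWeight_of_not_mem_slab {j : Fin 3} {ξ : EuclideanSpace ℝ (Fin 3)}
    (hξ : ξ ∉ {ξ : EuclideanSpace ℝ (Fin 3) | |ξ j| ≤ (2 * Real.pi)⁻¹}) :
    1 < ENNReal.ofReal ((2 * Real.pi * |ξ j|) ^ 2) := by
  rw [ENNReal.one_lt_ofReal]
  have hpi : 0 < 2 * Real.pi := by positivity
  have h1 : 1 < 2 * Real.pi * |ξ j| := by
    have : (2 * Real.pi)⁻¹ < |ξ j| := lt_of_not_ge hξ
    calc (1 : ℝ) = 2 * Real.pi * (2 * Real.pi)⁻¹ := by field_simp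
      _ < 2 * Real.pi * |ξ j| := mul_lt_mul_of_pos_left this hpi
  nlinarith

/-- On the slab the weight is at most one: `|ξ_j| ≤ 1/(2π) ⇒ (2π|ξ_j|)² ≤ 1`. [folklore] -/
private theorem symbolWeight_le_one_of_mem_slab {j : Fin 3} {ξ : EuclideanSpace ℝ (Fin 3)}
    (hξ : ξ ∈ {ξ : EuclideanSpace ℝ (Fin 3) | |ξ j| ≤ (2 * Real.pi)⁻¹}) :
    ENNReal.ofReal ((2 * Real.pi * |ξ j|) ^ 2) ≤ 1 := by
  rw [← ENNReal.ofReal_one]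
  apply ENNReal.ofReal_le_ofReal
  have hpi : 0 < 2 * Real.pi := by positivity
  have h0 : 0 ≤ 2 * Real.pi * |ξ j| := by positivity
  have h1 : 2 * Real.pi * |ξ j| ≤ 1 := by
    have : |ξ j| ≤ (2 * Real.pi)⁻¹ := hξ
    calc 2 * Real.pi * |ξ j| ≤ 2 * Real.pi * (2 * Real.pi)⁻¹ := mul_le_mul_of_nonneg_left this hpi.le
      _ = 1 := by field_simp
  nlinarith

/-- **PALEY–WIENER HALF (the max-norm class ⊆ band-limited): if ALL the moments
`∫ (2π|ξ_j|)^{2m} |f̂(ξ)|² dξ = ‖∂_j^m f‖²_{L²}` (Plancherel) of `f ∈ L²(ℝ³; ℂ³)` are bounded by one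
`K < ∞`, then `f̂ = 0` a.e. off the slab `{|ξ_j| ≤ 1/(2π)}`** — `f` is band-limited (in direction
`j`) in the sense of `Tao2016.IsBandLimited`. With all three directions: Fourier support in the
cube of side `1/π`. So «`‖u‖_{H^∞} = max_m Σ_j ‖∂_j^m u‖_{L²} < ∞`» [cite: Han2013, (norm0)/(S-HI) l.163–174]
is a SUPPORT condition on `û`, defining a closed linear subspace — not an order of smoothness.
[cite: BahouriCheminDanchinGL343, Lemma 2.1 (Bernstein inequalities), book p. 52 — `L²` case with its converse] -/
theorem isBandLimited_slab_of_uniform_moments (f : L2C) (j : Fin 3) {K : ℝ≥0∞} (hK : K ≠ ∞)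
    (h : ∀ m : ℕ, ∫⁻ ξ, ENNReal.ofReal ((2 * Real.pi * |ξ j|) ^ (2 * m)) * ‖fourierFn f ξ‖ₑ ^ 2 ≤ K) :
    IsBandLimited {ξ : EuclideanSpace ℝ (Fin 3) | |ξ j| ≤ (2 * Real.pi)⁻¹} f := by
  have hG : AEMeasurable (fun ξ : EuclideanSpace ℝ (Fin 3) => ‖fourierFn f ξ‖ₑ ^ 2) volume :=
    (aestronglyMeasurable_fourierFn f).enorm.pow_const 2
  have h' : ∀ m : ℕ, ∫⁻ ξ, (ENNReal.ofReal ((2 * Real.pi * |ξ j|) ^ 2)) ^ m * ‖fourierFn f ξ‖ₑ ^ 2 ≤ K := by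
    intro m
    refine le_of_eq_of_le (lintegral_congr fun ξ => ?_) (h m)
    rw [← ENNReal.ofReal_pow (by positivity), ← pow_mul]
  have hae := ae_eq_zero_of_uniform_moments (measurable_symbolWeight j) hG hK h'
  unfold IsBandLimited
  filter_upwards [hae] with ξ hξ hnot
  have h0 : ‖fourierFn f ξ‖ₑ ^ 2 = 0 := hξ (one_lt_symbolWeight_of_not_mem_slab hnot)
  simpa using h0

/-- **BERNSTEIN HALF (band-limited ⊆ the max-norm class): if `f̂ = 0` a.e. off the slab
`{|ξ_j| ≤ 1/(2π)}`, every moment `∫ (2π|ξ_j|)^{2m} |f̂|² = ‖∂_j^m f‖²_{L²}` is bounded by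
`∫ |f̂|² = ‖f‖²_{L²}`**, uniformly in `m`. [cite: BahouriCheminDanchinGL343, Lemma 2.1 (Bernstein inequalities), book p. 52 — `L²` case with its converse] -/
theorem uniform_moments_of_isBandLimited_slab (f : L2C) (j : Fin 3)
    (hf : IsBandLimited {ξ : EuclideanSpace ℝ (Fin 3) | |ξ j| ≤ (2 * Real.pi)⁻¹} f) (m : ℕ) :
    ∫⁻ ξ, ENNReal.ofReal ((2 * Real.pi * |ξ j|) ^ (2 * m)) * ‖fourierFn f ξ‖ₑ ^ 2 ≤
      ∫⁻ ξ, ‖fourierFn f ξ‖ₑ ^ 2 := by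
  have hae : ∀ᵐ ξ ∂(volume : Measure (EuclideanSpace ℝ (Fin 3))),
      1 < ENNReal.ofReal ((2 * Real.pi * |ξ j|) ^ 2) → ‖fourierFn f ξ‖ₑ ^ 2 = 0 := by
    filter_upwards [hf] with ξ hξ h1
    have hnot : ξ ∉ {ξ : EuclideanSpace ℝ (Fin 3) | |ξ j| ≤ (2 * Real.pi)⁻¹} := fun hmem =>
      absurd (symbolWeight_le_one_of_mem_slab hmem) (not_le.2 h1)
    rw [hξ hnot, enorm_zero, zero_pow two_ne_zero]
  calc ∫⁻ ξ, ENNReal.ofReal ((2 * Real.pi * |ξ j|) ^ (2 * m)) * ‖fourierFn f ξ‖ₑ ^ 2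
      = ∫⁻ ξ, (ENNReal.ofReal ((2 * Real.pi * |ξ j|) ^ 2)) ^ m * ‖fourierFn f ξ‖ₑ ^ 2 :=
        lintegral_congr fun ξ => by rw [← ENNReal.ofReal_pow (by positivity), ← pow_mul]
    _ ≤ ∫⁻ ξ, ‖fourierFn f ξ‖ₑ ^ 2 := lintegral_pow_mul_le_of_ae_zero hae m

/-- **BARRIER: the «`H^∞` max-norm» class (all pure derivatives uniformly bounded in `L²`) is
EXACTLY the band-limited class, in each direction: `sup_m ‖∂_j^m f‖_{L²} < ∞ ⇔ supp f̂ ⊆ {|ξ_j| ≤ 1/(2π)}`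
(Fourier side, Plancherel dictionary `‖∂_j^m f‖²_{L²} = ∫(2π|ξ_j|)^{2m}|f̂|²`).** Hence it is a
closed linear subspace cut out by a SUPPORT condition, and whether a quadratic quantity such as
`(u·∇)u` (Fourier transform `= 2πi ∫ (û(η)·ξ) û(ξ−η) dη`, supported up to the DOUBLED cube) belongs
to it is a question about the vanishing of a convolution on the outer shell — generically NO
(explicitly no for the Taylor–Green datum: `BandLimited.not_bddAbove_dirDeriv_convect_velocity`).

BARRIER (structured block, D-0021):
- technique_class: sup-over-all-orders-sobolev-norm max-norm-H-infinity band-limited-data compact-fourier-support linear-stokes-estimates-transferred-to-the-convective-term gronwall-in-extended-reals energy-method restricted-data-class — cell `ns-claims` classes T1 (energy method) with a T11 flag (linear estimates transferred), census family «reduction-to-linear / restricted data» [cite: Han2013, Lemma 2.1 l.435–470 and Lemma 4.1 l.831–845]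
- blocks: for NavierStokesRegularity (regularity side), every scheme whose controlled quantity is FINITE ONLY ON BAND-LIMITED FIELDS (equivalently, by this theorem, any «max over all derivative orders» of `L²` norms with unit weights; likewise fixed-radius analytic norms `sup_m r^m‖∇^m u‖/m!` up to the radius dictionary) and which propagates that quantity TIME-UNIFORMLY along the forced Stokes flow or along Navier–Stokes, in particular every estimate of the shape `‖(u·∇)u(t)‖_X ≤ G(‖u₀‖_X, ‖(u₀·∇)u₀‖_X, ∫‖f‖_X)` with `X` the max-norm class [cite: Han2013, (EnEs-LNS3)/(EnEs-LNS4) l.448–470]: the right side is finite on the class while the left side is `+∞` as soon as `û(t)` meets the outer shell, which the quadratic term produces from band-edge modes (Taylor–Green: datum on `|k_j| ≤ 1`, `(u·∇)u` and `ℙ(u·∇)u` on `|k_j| = 2`; forced Stokes with band-edge eigenmode forcing `f`: `u(t) = c(t)f`, `(u·∇)u(t) = c(t)²(f·∇)f`); the printed closing move «sum over `j`, max over `m`, then Gronwall» is then Gronwall applied in `[0,∞]` to `X(t) = ‖(u·∇)u(t)‖²`, `X(0) < ∞`, `X(t) = ⊤` for `t > 0` — kernel-false (`Summit.NavierStokesRegularity.NavierStokesRegularity.Theorems.Han2013.not_Step_L21G`,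 and with pointwise finiteness `not_Step_L21G_ptFinite`) [cite: Han2013, proof of Lemma 2.1, sentence after (2.21), l.575–578]
- because: (i) `ae_eq_zero_of_uniform_moments` / `isBandLimited_slab_of_uniform_moments`: bounded moments of all orders ⇒ `f̂ = 0` a.e. off the slab (shell-by-shell: `(1+ε)^m ∫_{w≥1+ε}|f̂|² ≤ K` for all `m`); (ii) `uniform_moments_of_isBandLimited_slab`: the converse (Bernstein); (iii) products double the band — physical side `BandLimited.abs_dirDeriv_velocity_le_one` (all `|∂_j^m u_i| ≤ 1`) versus `BandLimited.abs_dirDeriv_convect_eq` / `not_bddAbove_dirDeriv_convect_velocity` (`|∂_1^m((u·∇)u)_1|` attains `2^m/2`) on the tree's Taylor–Green datum, whose projected nonlinearity and initial acceleration also live on the doubled modes (`TaylorGreenVortex.convect_add_gradient_pressure`, `initialAcceleration_eq`) [cite: TaylorGreen1937, eqs. (12)–(19)]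
- evasions_known: (a) a TIME-DEPENDENT analyticity / Gevrey radius — Foias–Temam: for `H¹` data the solution is in a Gevrey class with radius growing like `t` on a short interval, and all such results LOSE the radius or the time-uniformity; they never assert a fixed band [cite: FoiasTemam1989, Thm. p. 360 (Gevrey class regularity, radius growing like `t` for small `t`)]; tree: `Literature/Analysis/FluidPDE/NSAnalyticityRadiusLinfty.lean`, `NSLocalAnalyticityRadius*.lean`, barrier `TimeTaylorFiniteRadius` (the time-series analogue); (b) Galerkin / frequency-TRUNCATED systems, where the band IS invariant because the equation is changed (`ℙ_N B(u,u)`; tree `Torus.galerkinFlow`) — a statement about the truncated ODE, not about Navier–Stokes; (c) small band-limited (indeed small `Ḣ^{1/2}`/`L³`/`BMO⁻¹`) data are globally regular by perturbation theory, independently of the band (tree `Literature.Analysis.FluidPDE.kato_global_small_holds`, `hasGlobalFujitaKatoSolution_of_le_fkDelta`; barrier `SmallDataGlobalRegularity`); (d) the heat/Stokes flow ALONE does preserve every band and contracts every `‖∂_j^m ·‖_{L²}` (Fourier multiplier of modulus ≤ 1: tree `Tao2016.IsBandLimited.heat`, `norm_fourierMultiplier_le_of_bound`) — the linear estimate (EnEs-LNS1)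 for `u` itself is true for the semigroup solution; only the transfer to `(u·∇)u` fails
- scope_caveats: (i) phrased on the FOURIER side for `f ∈ L²(ℝ³; ℂ³)` with the representative `Tao2016.fourierFn`; the dictionary `‖∂_j^m f‖²_{L²} = ∫ (2π|ξ_j|)^{2m}|f̂|²` (Plancherel + `∂_j ↔ 2πiξ_j`) is classical and not re-proved here [cite: BahouriCheminDanchinGL343, Lemma 2.1 (Bernstein inequalities), book p. 52 — `L²` case with its converse]; (ii) the product/doubling statement is proved for the explicit periodic Taylor–Green field with SUP norms of directional derivatives (companion file) — the `L²(ℝ³)` witness (a Schwartz divergence-free band-limited field whose convective term is not band-limited to the same cube, e.g. `û ≥ 0`-bump constructions via the support of an autoconvolution) is described, not formalised; (iii) NOTHING here limits schemes whose controlled norm is finite on a flow-invariant class (all classical `H^s`, `L^p`, Besov scales), nor conditional results that ASSUME a band for all times; (iv) the unit-cube normalisation `|ξ_j| ≤ 1/(2π)` comes from Mathlib's Fourier convention `e^{−2πi x·ξ}`; any other cube is a rescaling; (v) silent about the torus, where the same dichotomy reads «finitely many Fourier modes» (Han's Thms 1.3/1.4 «line by line») and the doubling is literally the Taylor–Gr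een computation
- status: established (proved here and in `BandLimitedFrequencyDoubling.lean`; Mathlib measure theory + the tree's `Tao2016` `L²`-Fourier vocabulary and Taylor–Green file)
[cite: Han2013, Lemma 2.1 (EnEs-LNS3) l.448–470 with l.575–578] -/
theorem uniform_moments_iff_isBandLimited_slab (f : L2C) (j : Fin 3) :
    (∃ K : ℝ≥0∞, K ≠ ∞ ∧
        ∀ m : ℕ, ∫⁻ ξ, ENNReal.ofReal ((2 * Real.pi * |ξ j|) ^ (2 * m)) * ‖fourierFn f ξ‖ₑ ^ 2 ≤ K) ↔
      IsBandLimited {ξ : EuclideanSpace ℝ (Fin 3) | |ξ j| ≤ (2 * Real.pi)⁻¹} f := by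
  constructor
  · rintro ⟨K, hK, h⟩
    exact isBandLimited_slab_of_uniform_moments f j hK h
  · intro hf
    refine ⟨∫⁻ ξ, ‖fourierFn f ξ‖ₑ ^ 2, ?_, uniform_moments_of_isBandLimited_slab f j hf⟩
    -- `∫ |f̂|² < ∞` since `f̂ ∈ L²`
    have hmem : MemLp (fourierFn f) 2 (volume : Measure (EuclideanSpace ℝ (Fin 3))) := by
      unfold fourierFn
      exact Lp.memLp _
    have := hmem.eLpNorm_lt_top
    rw [eLpNorm_eq_lintegral_rpow_enorm_toReal two_ne_zero ENNReal.ofNat_ne_top] at this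
    have h2 : ∫⁻ ξ, ‖fourierFn f ξ‖ₑ ^ 2 = ∫⁻ ξ, ‖fourierFn f ξ‖ₑ ^ ((2 : ℝ≥0∞).toReal) := by
      refine lintegral_congr fun ξ => ?_
      rw [ENNReal.toReal_ofNat]
      exact (ENNReal.rpow_natCast _ 2).symm
    rw [h2]
    intro htop
    rw [htop, ENNReal.top_rpow_of_pos (by norm_num)] at this
    exact lt_irrefl _ this

end Slab

end BandLimited

end Literature.Barriers.NavierStokesRegularity
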